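import Literature.NumberTheory.Rogawski1990.LocalTransferTorusSingularSideSumsCM           -- ★ p841594 F0P2-p02 (g8): `finsum_mem_side_eq_finsum_weighted` (weighted ε-side re-indexing)
import Literature.NumberTheory.Rogawski1990.LocalTransferChartRealisationPointwise         -- ★ p841581 F0P2-p02 (g8): realisation with `P` only at the evaluation point
import HarnessLib

/-!
# THE TORUS–SINGULAR JUNCTION, INVARIANT FORM — `R_φ` is a local stable orbital integral at `ε_H = (A_{a,b}, a)` (H-regular, G-singular), with STABLY SATURATED
# descent windows and an abstract bad side (Rogawski 1990 Prop. 8.2.1 (c); Langlands–Shelstad descent §2.4; the (R-inv) grammar of record, LEAD T8-82 (B))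

Topic `NumberTheory/Rogawski1990`; namespace `Literature.NumberTheory.Rogawski1990`.  TWO THEOREMS + one private splitting lemma (no definition, no instance, no notation, no named
fact, no `sorry`).  Cell `pub/hodgecm-mathlib` (D-0151), crux H413 = stmt-HodgeConjecture-24833, floor-2 line «N6nsGerm» (stub `stub_N6nsS2`); seat F0P2-p02 (g8) (pen).
WHY THIS EDITION.  ★ p841614 `exists_nhds_stableOrbitalIntegralRel_eq_of_torus_singular` carries a CLASS-LEVEL saturation binder `hsat` at the base point `ε♭` of `H♭`, which the
saturation theorem in the tree (★ p841310, STABLE-level) does not discharge (F0P3a-p08 (g13) books check 05:48Z).  As in p08's (R-inv) S1 junction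
`LocalTransferCentralSingularJunctionInvCM`, the fix is to let the DESCENT and SEPARATION windows be STABLY SATURATED neighbourhoods of `ε♭` (then every element stably conjugate
to `τ t ∈ B` lies in `B` with the identity conjugator, and ★ `finsum_mem_side_eq_finsum_weighted`'s `hsatB` is free), and to make the bad (`ε′`, compact) side an ABSTRACT predicate
`Q′ t γ′` (read by the sided uniform fibre `hside`, the disjointness `hdisj`, and the compact-side vanishing `hI0`).  HONEST LABEL: HC_CM is proved only modulo the printed citations
until rung 0 closes; this file proves `stub_N6nsS2` ONLY MODULO its binders (torus chart + torus Haar at `ε_H`, dock `θ` and torus transport `τ`, saturated SEP′, sided uniform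
fibre, saturated DESCENT (the S1 object at `ε♭`), (R1-lc), compact-side vanishing).

## References
* [Rogawski1990] J. Rogawski, *Automorphic Representations of Unitary Groups in Three Variables*, Ann. of Math. Stud. 123 (1990): §8.2 Prop. 8.2.1 (c) pp. 113–115; §4.9 Lemma 4.9.3 p. 56; §4.3 (4.3.1) p. 43.
* [LanglandsShelstad1990Descent] R. P. Langlands, D. Shelstad, *Descent for transfer factors* (1990): §2.4.
* [LabesseLanglands1979] J.-P. Labesse, R. P. Langlands, *L-indistinguishability for SL(2)*, Canad. J. Math. 31 (1979): §2 (the rank-one input (R1), a binder here).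
-/

set_option autoImplicit false

noncomputable section

open Set Filter Topology MeasureTheory Polynomial
open scoped Pointwise Matrix

namespace Literature.NumberTheory.Rogawski1990

open Literature.NumberTheory.Automorphic Literature.NumberTheory.Automorphic.UnitaryGroup Literature.NumberTheory.GaloisRepresentations
open _root_.NumberField _root_.IsDedekindDomain

section TorusSingularInv

variable (L : Type) [Field L] [NumberField L] [IsCMField L] (H' : Matrix (Fin 3) (Fin 3) L) (v : HeightOneSpectrum (𝓞 ↥(maximalRealSubfield L)))

/-- Splitting a finitely supported sum along two disjoint predicates covering the support. [folklore] -/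
private theorem finsum_eq_finsum_mem_add_finsum_mem₂ {ι : Type*} (F : ι → ℂ) (hF : (Function.support F).Finite) (P Q : ι → Prop)
    (hcover : ∀ c, F c ≠ 0 → P c ∨ Q c) (hdisj : ∀ c, P c → Q c → False) :
    ∑ᶠ c, F c = (∑ᶠ c ∈ {c | P c}, F c) + ∑ᶠ c ∈ {c | Q c}, F c := by
  classical
  have hsplit : ∀ c, F c = (if P c then F c else 0) + (if Q c then F c else 0) := by
    intro c
    by_cases h0 : F c = 0
    · simp only [h0, ite_self, add_zero]
    · rcases hcover c h0 with hP | hQ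
      · rw [if_pos hP, if_neg (fun hQ => hdisj c hP hQ), add_zero]
      · rw [if_neg (fun hP => hdisj c hP hQ), if_pos hQ, zero_add]
  have hfin₁ : (Function.support fun c => if P c then F c else 0).Finite :=
    hF.subset fun c hc => by
      simp only [Function.mem_support, ne_eq, ite_eq_right_iff, Classical.not_imp] at hc ⊢
      exact hc.2
  have hfin₂ : (Function.support fun c => if Q c then F c else 0).Finite :=
    hF.subset fun c hc => by
      simp only [Function.mem_support, ne_eq, ite_eq_right_iff, Classical.not_imp] at hc ⊢
      exact hc.2
  have hite : ∀ R : ι → Prop, (∑ᶠ c, if R c then F c else 0) = ∑ᶠ c ∈ {c | R c}, F c := by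
    intro R
    rw [finsum_mem_def]
    exact finsum_congr fun c => (Set.indicator_apply _ _ _).symm
  rw [← hite, ← hite, ← finsum_add_distrib hfin₁ hfin₂]
  exact finsum_congr hsplit

variable [iM' : ∀ γ : (cmDatum L 3 H').Local v, MeasurableSpace ((cmDatum L 3 H').Local v ⧸ Subgroup.centralizer ({γ} : Set ((cmDatum L 3 H').Local v)))]
  [iH : ∀ a : ((cmDatum L 2 (Matrix.of fun i j : Fin 2 => if i.val + j.val + 1 = 2 then (1 : L) else 0)).Local v ×
      (cmDatum L 1 (Matrix.of fun i j : Fin 1 => if i.val + j.val + 1 = 1 then (1 : L) else 0)).Local v), MeasurableSpace (((cmDatum L 2 (Matrix.of fun i j : Fin 2 => if i.val + j.val + 1 = 2 then (1 : L) else 0)).Local v ×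
      (cmDatum L 1 (Matrix.of fun i j : Fin 1 => if i.val + j.val + 1 = 1 then (1 : L) else 0)).Local v) ⧸ Subgroup.centralizer ({a} : Set ((cmDatum L 2 (Matrix.of fun i j : Fin 2 => if i.val + j.val + 1 = 2 then (1 : L) else 0)).Local v ×
      (cmDatum L 1 (Matrix.of fun i j : Fin 1 => if i.val + j.val + 1 = 1 then (1 : L) else 0)).Local v)))]

/-- **THE TORUS-POINT IDENTITY, ABSTRACT BAD SIDE** (Prop. 8.2.1 (c), pointwise bookkeeping; the `Q`-generic twin of ★ `finsum_delta_mul_classOrbitalIntegral_eq_of_sides`).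
At a `G`-regular `a ∈ H_v` with base element `γ` (`G`-regular) and a good-side window `B ⊆ H_v`: if every class matched with `a` is conjugate into `θ(B)` at a point stably
conjugate to `γ` or satisfies the bad-side predicate `Q` (`hside`), never both (`hdj`), the good-side data (saturation into `B`, SEP′, descent) hold, the weighted good-side sum
has the value `gval` and the `Q`-side vanishes, then `Σᶠ_c Δ_v(a, c)·Φ(c, φ) = gval`. [cite: Rogawski1990, §8.2 Prop. 8.2.1 (c) pp. 113–115; §4.3 (4.3.1) p. 43] [cite: LanglandsShelstad1990Descent, §2.4] -/
theorem finsum_delta_mul_classOrbitalIntegral_eq_of_sides_of_pred (hH' : (H'.map (cmConjRingHom L))ᵀ = H') (hdet' : H'.det ≠ 0) (μ : HeckeCharacter L)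
    (hl : ∀ (v : HeightOneSpectrum (𝓞 ↥(maximalRealSubfield L))) (a : ((cmDatum L 2 (Matrix.of fun i j : Fin 2 => if i.val + j.val + 1 = 2 then (1 : L) else 0)).Local v ×
      (cmDatum L 1 (Matrix.of fun i j : Fin 1 => if i.val + j.val + 1 = 1 then (1 : L) else 0)).Local v)) (b : (cmDatum L 3 H').Local v) (x : ((cmDatum L 2 (Matrix.of fun i j : Fin 2 => if i.val + j.val + 1 = 2 then (1 : L) else 0)).Local v ×
      (cmDatum L 1 (Matrix.of fun i j : Fin 1 => if i.val + j.val + 1 = 1 then (1 : L) else 0)).Local v)),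
      finExplicitDelta L v H' (x * a * x⁻¹) μ b = finExplicitDelta L v H' a μ b)
    (hr : ∀ (v : HeightOneSpectrum (𝓞 ↥(maximalRealSubfield L))) (a : ((cmDatum L 2 (Matrix.of fun i j : Fin 2 => if i.val + j.val + 1 = 2 then (1 : L) else 0)).Local v ×
      (cmDatum L 1 (Matrix.of fun i j : Fin 1 => if i.val + j.val + 1 = 1 then (1 : L) else 0)).Local v)) (b y : (cmDatum L 3 H').Local v),
      finExplicitDelta L v H' a μ (y * b * y⁻¹) = finExplicitDelta L v H' a μ b)
    (mH : OrbitalMeasureFamily ((cmDatum L 2 (Matrix.of fun i j : Fin 2 => if i.val + j.val + 1 = 2 then (1 : L) else 0)).Local v ×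
      (cmDatum L 1 (Matrix.of fun i j : Fin 1 => if i.val + j.val + 1 = 1 then (1 : L) else 0)).Local v)) (mG : OrbitalMeasureFamily ((cmDatum L 3 H').Local v))
    {ε : (cmDatum L 3 H').Local v} (θ : ((cmDatum L 2 (Matrix.of fun i j : Fin 2 => if i.val + j.val + 1 = 2 then (1 : L) else 0)).Local v ×
      (cmDatum L 1 (Matrix.of fun i j : Fin 1 => if i.val + j.val + 1 = 1 then (1 : L) else 0)).Local v) ≃ₜ* ↥(Subgroup.centralizer ({ε} : Set ((cmDatum L 3 H').Local v)))) (a γ : ((cmDatum L 2 (Matrix.of fun i j : Fin 2 => if i.val + j.val + 1 = 2 then (1 : L) else 0)).Local v ×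
      (cmDatum L 1 (Matrix.of fun i j : Fin 1 => if i.val + j.val + 1 = 1 then (1 : L) else 0)).Local v)) (B : Set ((cmDatum L 2 (Matrix.of fun i j : Fin 2 => if i.val + j.val + 1 = 2 then (1 : L) else 0)).Local v ×
      (cmDatum L 1 (Matrix.of fun i j : Fin 1 => if i.val + j.val + 1 = 1 then (1 : L) else 0)).Local v)) (Q : ConjClasses ((cmDatum L 3 H').Local v) → Prop)
    (φ : (cmDatum L 3 H').Local v → ℂ) (φε : ((cmDatum L 2 (Matrix.of fun i j : Fin 2 => if i.val + j.val + 1 = 2 then (1 : L) else 0)).Local v ×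
      (cmDatum L 1 (Matrix.of fun i j : Fin 1 => if i.val + j.val + 1 = 1 then (1 : L) else 0)).Local v) → ℂ) (gval : ℂ) (ha : IsLocalGRegular L v a) (hγ : IsLocalGRegular L v γ) (hφ : IsLocSmooth φ)
    (hside : ∀ γ' : (cmDatum L 3 H').Local v, IsLocalNormPair L H' v a γ' →
      (∃ x : (cmDatum L 3 H').Local v, ∃ h ∈ B, IsLocalStablyConjH L v γ h ∧ x * γ' * x⁻¹ = ((θ h : ↥(Subgroup.centralizer ({ε} : Set ((cmDatum L 3 H').Local v)))) : (cmDatum L 3 H').Local v)) ∨ Q (ConjClasses.mk γ'))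
    (hdj : ∀ c : ConjClasses ((cmDatum L 3 H').Local v), (∃ x : (cmDatum L 3 H').Local v, ∃ h ∈ B, IsLocalStablyConjH L v γ h ∧ x * Quotient.out c * x⁻¹ = ((θ h : ↥(Subgroup.centralizer ({ε} : Set ((cmDatum L 3 H').Local v)))) : (cmDatum L 3 H').Local v)) → Q c → False)
    (hsatB : ∀ h' : ((cmDatum L 2 (Matrix.of fun i j : Fin 2 => if i.val + j.val + 1 = 2 then (1 : L) else 0)).Local v ×
      (cmDatum L 1 (Matrix.of fun i j : Fin 1 => if i.val + j.val + 1 = 1 then (1 : L) else 0)).Local v), IsLocalStablyConjH L v γ h' → ∃ x : ((cmDatum L 2 (Matrix.of fun i j : Fin 2 => if i.val + j.val + 1 = 2 then (1 : L) else 0)).Local v ×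
      (cmDatum L 1 (Matrix.of fun i j : Fin 1 => if i.val + j.val + 1 = 1 then (1 : L) else 0)).Local v), x * h' * x⁻¹ ∈ B)
    (hsepB : ∀ h ∈ B, ∀ h' ∈ B, ∀ x : (cmDatum L 3 H').Local v, x * ((θ h : ↥(Subgroup.centralizer ({ε} : Set ((cmDatum L 3 H').Local v)))) : (cmDatum L 3 H').Local v) * x⁻¹ = ((θ h' : ↥(Subgroup.centralizer ({ε} : Set ((cmDatum L 3 H').Local v)))) : (cmDatum L 3 H').Local v) → IsConj h h')
    (hdescB : ∀ h ∈ B, IsLocalGRegular L v h →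
      classOrbitalIntegral mG φ (ConjClasses.mk ((θ h : ↥(Subgroup.centralizer ({ε} : Set ((cmDatum L 3 H').Local v)))) : (cmDatum L 3 H').Local v)) = classOrbitalIntegral mH φε (ConjClasses.mk h))
    (hval : (∑ᶠ d ∈ {d : ConjClasses ((cmDatum L 2 (Matrix.of fun i j : Fin 2 => if i.val + j.val + 1 = 2 then (1 : L) else 0)).Local v ×
      (cmDatum L 1 (Matrix.of fun i j : Fin 1 => if i.val + j.val + 1 = 1 then (1 : L) else 0)).Local v) | IsLocalStablyConjH L v γ (Quotient.out d)},
        ((finExplicitCollection L H' μ hl hr) v).Δ a ((θ (Quotient.out d) : ↥(Subgroup.centralizer ({ε} : Set ((cmDatum L 3 H').Local v)))) : (cmDatum L 3 H').Local v) * classOrbitalIntegral mH φε d) = gval)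
    (hzero : (∑ᶠ c ∈ {c : ConjClasses ((cmDatum L 3 H').Local v) | Q c}, ((finExplicitCollection L H' μ hl hr) v).Δ a (Quotient.out c) * classOrbitalIntegral mG φ c) = 0) :
    (∑ᶠ c : ConjClasses ((cmDatum L 3 H').Local v), ((finExplicitCollection L H' μ hl hr) v).Δ a (Quotient.out c) * classOrbitalIntegral mG φ c) = gval := by
  classical
  have hΔT : ∀ (a' : ((cmDatum L 2 (Matrix.of fun i j : Fin 2 => if i.val + j.val + 1 = 2 then (1 : L) else 0)).Local v ×
      (cmDatum L 1 (Matrix.of fun i j : Fin 1 => if i.val + j.val + 1 = 1 then (1 : L) else 0)).Local v)) (b : (cmDatum L 3 H').Local v), ((finExplicitCollection L H' μ hl hr) v).Δ a' b = finExplicitDelta L v H' a' μ b :=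
    fun a' b => finExplicitCollection_Δ L H' μ hl hr v a' b
  have hregB : ∀ h : ((cmDatum L 2 (Matrix.of fun i j : Fin 2 => if i.val + j.val + 1 = 2 then (1 : L) else 0)).Local v ×
      (cmDatum L 1 (Matrix.of fun i j : Fin 1 => if i.val + j.val + 1 = 1 then (1 : L) else 0)).Local v), IsLocalStablyConjH L v γ h → IsLocalGRegular L v h :=
    fun h hst => isGRegular_of_isStablyConjH _ _ _ _ hst hγ
  have hFfin : (Function.support fun c : ConjClasses ((cmDatum L 3 H').Local v) =>
      ((finExplicitCollection L H' μ hl hr) v).Δ a (Quotient.out c) * classOrbitalIntegral mG φ c).Finite :=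
    finite_support_delta_mul_classOrbitalIntegral_of_isLocSmooth L H' v hH' hdet' _ mG φ hφ a ha
  rw [finsum_eq_finsum_mem_add_finsum_mem₂ _ hFfin
    (fun c => ∃ x : (cmDatum L 3 H').Local v, ∃ h ∈ B, IsLocalStablyConjH L v γ h ∧ x * Quotient.out c * x⁻¹ = ((θ h : ↥(Subgroup.centralizer ({ε} : Set ((cmDatum L 3 H').Local v)))) : (cmDatum L 3 H').Local v)) Q
    (fun c hc => ?_) hdj]
  · rw [hzero, add_zero, ← hval]
    exact finsum_mem_side_eq_finsum_weighted L H' v μ hl hr mH mG θ a γ B φ φε hsatB hsepB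
      (fun h hhB hst => hdescB h hhB (hregB h hst))
  · have hR : IsLocalNormPair L H' v a (Quotient.out c) := by
      by_contra hR
      apply hc
      simp only [hΔT, finExplicitDelta_of_not_isLocalNormPair L v H' a μ hR, zero_mul]
    rcases hside _ hR with h1 | h2
    · exact Or.inl h1
    · right
      have hc' : ConjClasses.mk (Quotient.out c) = c := by rw [← ConjClasses.quotient_mk_eq_mk, Quotient.out_eq]
      rw [hc'] at h2
      exact h2

variable [MeasurableSpace ((cmDatum L 2 (Matrix.of fun i j : Fin 2 => if i.val + j.val + 1 = 2 then (1 : L) else 0)).Local v ×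
      (cmDatum L 1 (Matrix.of fun i j : Fin 1 => if i.val + j.val + 1 = 1 then (1 : L) else 0)).Local v)] [BorelSpace ((cmDatum L 2 (Matrix.of fun i j : Fin 2 => if i.val + j.val + 1 = 2 then (1 : L) else 0)).Local v ×
      (cmDatum L 1 (Matrix.of fun i j : Fin 1 => if i.val + j.val + 1 = 1 then (1 : L) else 0)).Local v)]
  [iHB : ∀ a : ((cmDatum L 2 (Matrix.of fun i j : Fin 2 => if i.val + j.val + 1 = 2 then (1 : L) else 0)).Local v ×
      (cmDatum L 1 (Matrix.of fun i j : Fin 1 => if i.val + j.val + 1 = 1 then (1 : L) else 0)).Local v), BorelSpace (((cmDatum L 2 (Matrix.of fun i j : Fin 2 => if i.val + j.val + 1 = 2 then (1 : L) else 0)).Local v ×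
      (cmDatum L 1 (Matrix.of fun i j : Fin 1 => if i.val + j.val + 1 = 1 then (1 : L) else 0)).Local v) ⧸ Subgroup.centralizer ({a} : Set ((cmDatum L 2 (Matrix.of fun i j : Fin 2 => if i.val + j.val + 1 = 2 then (1 : L) else 0)).Local v ×
      (cmDatum L 1 (Matrix.of fun i j : Fin 1 => if i.val + j.val + 1 = 1 then (1 : L) else 0)).Local v)))]

set_option maxHeartbeats 400000 in
/-- **`R_φ` IS A LOCAL STABLE ORBITAL INTEGRAL AT AN H-REGULAR, G-SINGULAR POINT — INVARIANT FORM (the body of `stub_N6nsS2`, hypothesis-driven; Rogawski 1990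
Prop. 8.2.1 (c)).**  As ★ `exists_nhds_stableOrbitalIntegralRel_eq_of_torus_singular` (p841614) but in the (R-inv) grammar of record: the transported separation window (`hsep′`) and
the DESCENT window (`hD`, the S1 object at the base point `ε♭`) are STABLY SATURATED neighbourhoods of `ε♭`; the bad (`ε′`, compact-centraliser) side is an ABSTRACT predicate
`Q′ t γ′` read by the SIDED uniform fibre (`hside`), the disjointness (`hdisj`) and the compact-side vanishing (`hI0`); NO class-level saturation binder.  The torus chart at `ε_H`
with its normalised Haar measure, the dock `θ` with the torus transport `τ` (`τ b₀ = ε♭`, `G`-regularity preserved), and (R1-lc) (the weighted good-side sum is the restriction of a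
locally constant function on the torus) are as before.  CONCLUSION: `∃ V ∈ 𝓝 ε_H, ∃ φ^H ∈ C_c^∞(H_v)`, `Φ^st_H(γ_H, φ^H) = Σᶠ_c Δ_v(γ_H, c)·Φ(c, φ)` for all `G`-regular `γ_H ∈ V`.
[cite: Rogawski1990, §8.2 Prop. 8.2.1 (c) pp. 113–115; §4.9 Lemma 4.9.3 p. 56; §4.3 (4.3.1) p. 43] [cite: LanglandsShelstad1990Descent, §2.4] [cite: LabesseLanglands1979, §2] -/
theorem exists_nhds_stableOrbitalIntegralRel_eq_of_torus_singular_inv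
    (hH' : (H'.map (cmConjRingHom L))ᵀ = H') (hdet' : H'.det ≠ 0) (μ : HeckeCharacter L)
    (hl : ∀ (v : HeightOneSpectrum (𝓞 ↥(maximalRealSubfield L))) (a : ((cmDatum L 2 (Matrix.of fun i j : Fin 2 => if i.val + j.val + 1 = 2 then (1 : L) else 0)).Local v ×
      (cmDatum L 1 (Matrix.of fun i j : Fin 1 => if i.val + j.val + 1 = 1 then (1 : L) else 0)).Local v)) (b : (cmDatum L 3 H').Local v) (x : ((cmDatum L 2 (Matrix.of fun i j : Fin 2 => if i.val + j.val + 1 = 2 then (1 : L) else 0)).Local v ×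
      (cmDatum L 1 (Matrix.of fun i j : Fin 1 => if i.val + j.val + 1 = 1 then (1 : L) else 0)).Local v)),
      finExplicitDelta L v H' (x * a * x⁻¹) μ b = finExplicitDelta L v H' a μ b)
    (hr : ∀ (v : HeightOneSpectrum (𝓞 ↥(maximalRealSubfield L))) (a : ((cmDatum L 2 (Matrix.of fun i j : Fin 2 => if i.val + j.val + 1 = 2 then (1 : L) else 0)).Local v ×
      (cmDatum L 1 (Matrix.of fun i j : Fin 1 => if i.val + j.val + 1 = 1 then (1 : L) else 0)).Local v)) (b y : (cmDatum L 3 H').Local v),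
      finExplicitDelta L v H' a μ (y * b * y⁻¹) = finExplicitDelta L v H' a μ b)
    (νH : Measure ((cmDatum L 2 (Matrix.of fun i j : Fin 2 => if i.val + j.val + 1 = 2 then (1 : L) else 0)).Local v ×
      (cmDatum L 1 (Matrix.of fun i j : Fin 1 => if i.val + j.val + 1 = 1 then (1 : L) else 0)).Local v)) [νH.IsHaarMeasure] [νH.IsMulRightInvariant]
    {mH : OrbitalMeasureFamily ((cmDatum L 2 (Matrix.of fun i j : Fin 2 => if i.val + j.val + 1 = 2 then (1 : L) else 0)).Local v ×
      (cmDatum L 1 (Matrix.of fun i j : Fin 1 => if i.val + j.val + 1 = 1 then (1 : L) else 0)).Local v)} {mG : OrbitalMeasureFamily ((cmDatum L 3 H').Local v)}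
    (hmH : mH.IsCanonical (IsLocalGRegular L v) νH)
    -- the H-regular, G-singular point and its torus
    (εH : ((cmDatum L 2 (Matrix.of fun i j : Fin 2 => if i.val + j.val + 1 = 2 then (1 : L) else 0)).Local v ×
      (cmDatum L 1 (Matrix.of fun i j : Fin 1 => if i.val + j.val + 1 = 1 then (1 : L) else 0)).Local v))
    (hTc : IsClosed ((Subgroup.centralizer ({εH} : Set ((cmDatum L 2 (Matrix.of fun i j : Fin 2 => if i.val + j.val + 1 = 2 then (1 : L) else 0)).Local v ×
      (cmDatum L 1 (Matrix.of fun i j : Fin 1 => if i.val + j.val + 1 = 1 then (1 : L) else 0)).Local v)) : Subgroup ((cmDatum L 2 (Matrix.of fun i j : Fin 2 => if i.val + j.val + 1 = 2 then (1 : L) else 0)).Local v ×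
      (cmDatum L 1 (Matrix.of fun i j : Fin 1 => if i.val + j.val + 1 = 1 then (1 : L) else 0)).Local v)) : Set ((cmDatum L 2 (Matrix.of fun i j : Fin 2 => if i.val + j.val + 1 = 2 then (1 : L) else 0)).Local v ×
      (cmDatum L 1 (Matrix.of fun i j : Fin 1 => if i.val + j.val + 1 = 1 then (1 : L) else 0)).Local v)))
    [MeasurableSpace (((cmDatum L 2 (Matrix.of fun i j : Fin 2 => if i.val + j.val + 1 = 2 then (1 : L) else 0)).Local v ×
      (cmDatum L 1 (Matrix.of fun i j : Fin 1 => if i.val + j.val + 1 = 1 then (1 : L) else 0)).Local v) ⧸ Subgroup.centralizer ({εH} : Set ((cmDatum L 2 (Matrix.of fun i j : Fin 2 => if i.val + j.val + 1 = 2 then (1 : L) else 0)).Local v ×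
      (cmDatum L 1 (Matrix.of fun i j : Fin 1 => if i.val + j.val + 1 = 1 then (1 : L) else 0)).Local v)))] [BorelSpace (((cmDatum L 2 (Matrix.of fun i j : Fin 2 => if i.val + j.val + 1 = 2 then (1 : L) else 0)).Local v ×
      (cmDatum L 1 (Matrix.of fun i j : Fin 1 => if i.val + j.val + 1 = 1 then (1 : L) else 0)).Local v) ⧸ Subgroup.centralizer ({εH} : Set ((cmDatum L 2 (Matrix.of fun i j : Fin 2 => if i.val + j.val + 1 = 2 then (1 : L) else 0)).Local v ×
      (cmDatum L 1 (Matrix.of fun i j : Fin 1 => if i.val + j.val + 1 = 1 then (1 : L) else 0)).Local v)))]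
    (ρ : Measure ↥(Subgroup.centralizer ({εH} : Set ((cmDatum L 2 (Matrix.of fun i j : Fin 2 => if i.val + j.val + 1 = 2 then (1 : L) else 0)).Local v ×
      (cmDatum L 1 (Matrix.of fun i j : Fin 1 => if i.val + j.val + 1 = 1 then (1 : L) else 0)).Local v)))) [ρ.IsHaarMeasure] [ρ.IsInvInvariant] (hρ : ρ (compactCore ↥(Subgroup.centralizer ({εH} : Set ((cmDatum L 2 (Matrix.of fun i j : Fin 2 => if i.val + j.val + 1 = 2 then (1 : L) else 0)).Local v ×
      (cmDatum L 1 (Matrix.of fun i j : Fin 1 => if i.val + j.val + 1 = 1 then (1 : L) else 0)).Local v)))) = 1)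
    -- (2ᵀ′) the torus chart at `ε_H`, with shrinking
    {AH : Type*} [TopologicalSpace AH] (sH : AH → ((cmDatum L 2 (Matrix.of fun i j : Fin 2 => if i.val + j.val + 1 = 2 then (1 : L) else 0)).Local v ×
      (cmDatum L 1 (Matrix.of fun i j : Fin 1 => if i.val + j.val + 1 = 1 then (1 : L) else 0)).Local v)) (eH : OpenPartialHomeomorph (AH × ↥(Subgroup.centralizer ({εH} : Set ((cmDatum L 2 (Matrix.of fun i j : Fin 2 => if i.val + j.val + 1 = 2 then (1 : L) else 0)).Local v ×
      (cmDatum L 1 (Matrix.of fun i j : Fin 1 => if i.val + j.val + 1 = 1 then (1 : L) else 0)).Local v)))) ((cmDatum L 2 (Matrix.of fun i j : Fin 2 => if i.val + j.val + 1 = 2 then (1 : L) else 0)).Local v ×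
      (cmDatum L 1 (Matrix.of fun i j : Fin 1 => if i.val + j.val + 1 = 1 then (1 : L) else 0)).Local v)) (aH : AH) (b₀ : ↥(Subgroup.centralizer ({εH} : Set ((cmDatum L 2 (Matrix.of fun i j : Fin 2 => if i.val + j.val + 1 = 2 then (1 : L) else 0)).Local v ×
      (cmDatum L 1 (Matrix.of fun i j : Fin 1 => if i.val + j.val + 1 = 1 then (1 : L) else 0)).Local v))))
    (heH : ∀ p ∈ eH.source, eH p = sH p.1 * (p.2 : ((cmDatum L 2 (Matrix.of fun i j : Fin 2 => if i.val + j.val + 1 = 2 then (1 : L) else 0)).Local v ×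
      (cmDatum L 1 (Matrix.of fun i j : Fin 1 => if i.val + j.val + 1 = 1 then (1 : L) else 0)).Local v)) * (sH p.1)⁻¹) (hsHc : Continuous sH) (hsH₁ : sH aH = 1) (hb₀ : (b₀ : ((cmDatum L 2 (Matrix.of fun i j : Fin 2 => if i.val + j.val + 1 = 2 then (1 : L) else 0)).Local v ×
      (cmDatum L 1 (Matrix.of fun i j : Fin 1 => if i.val + j.val + 1 = 1 then (1 : L) else 0)).Local v)) = εH)
    (hNH : ∀ N ∈ 𝓝 (aH, b₀), ∃ (K : Set AH) (B₁ : Set ↥(Subgroup.centralizer ({εH} : Set ((cmDatum L 2 (Matrix.of fun i j : Fin 2 => if i.val + j.val + 1 = 2 then (1 : L) else 0)).Local v ×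
      (cmDatum L 1 (Matrix.of fun i j : Fin 1 => if i.val + j.val + 1 = 1 then (1 : L) else 0)).Local v)))), IsCompact K ∧ IsOpen K ∧ aH ∈ K ∧ IsCompact B₁ ∧ IsOpen B₁ ∧ b₀ ∈ B₁ ∧
      K ×ˢ B₁ ⊆ N ∧ K ×ˢ B₁ ⊆ eH.source ∧
      (∀ t ∈ B₁, Subgroup.centralizer ({(t : ((cmDatum L 2 (Matrix.of fun i j : Fin 2 => if i.val + j.val + 1 = 2 then (1 : L) else 0)).Local v ×
      (cmDatum L 1 (Matrix.of fun i j : Fin 1 => if i.val + j.val + 1 = 1 then (1 : L) else 0)).Local v))} : Set ((cmDatum L 2 (Matrix.of fun i j : Fin 2 => if i.val + j.val + 1 = 2 then (1 : L) else 0)).Local v ×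
      (cmDatum L 1 (Matrix.of fun i j : Fin 1 => if i.val + j.val + 1 = 1 then (1 : L) else 0)).Local v)) = Subgroup.centralizer ({εH} : Set ((cmDatum L 2 (Matrix.of fun i j : Fin 2 => if i.val + j.val + 1 = 2 then (1 : L) else 0)).Local v ×
      (cmDatum L 1 (Matrix.of fun i j : Fin 1 => if i.val + j.val + 1 = 1 then (1 : L) else 0)).Local v))) ∧
      (∀ t ∈ B₁, ∀ x : ((cmDatum L 2 (Matrix.of fun i j : Fin 2 => if i.val + j.val + 1 = 2 then (1 : L) else 0)).Local v ×
      (cmDatum L 1 (Matrix.of fun i j : Fin 1 => if i.val + j.val + 1 = 1 then (1 : L) else 0)).Local v), x * (t : ((cmDatum L 2 (Matrix.of fun i j : Fin 2 => if i.val + j.val + 1 = 2 then (1 : L) else 0)).Local v ×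
      (cmDatum L 1 (Matrix.of fun i j : Fin 1 => if i.val + j.val + 1 = 1 then (1 : L) else 0)).Local v)) * x⁻¹ ∈ eH '' (K ×ˢ B₁) →
        x ∈ sH '' K * ((Subgroup.centralizer ({εH} : Set ((cmDatum L 2 (Matrix.of fun i j : Fin 2 => if i.val + j.val + 1 = 2 then (1 : L) else 0)).Local v ×
      (cmDatum L 1 (Matrix.of fun i j : Fin 1 => if i.val + j.val + 1 = 1 then (1 : L) else 0)).Local v)) : Subgroup ((cmDatum L 2 (Matrix.of fun i j : Fin 2 => if i.val + j.val + 1 = 2 then (1 : L) else 0)).Local v ×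
      (cmDatum L 1 (Matrix.of fun i j : Fin 1 => if i.val + j.val + 1 = 1 then (1 : L) else 0)).Local v)) : Set ((cmDatum L 2 (Matrix.of fun i j : Fin 2 => if i.val + j.val + 1 = 2 then (1 : L) else 0)).Local v ×
      (cmDatum L 1 (Matrix.of fun i j : Fin 1 => if i.val + j.val + 1 = 1 then (1 : L) else 0)).Local v))) ∧
      (∀ t ∈ B₁, ∀ t' ∈ B₁, IsLocalStablyConjH L v (t : ((cmDatum L 2 (Matrix.of fun i j : Fin 2 => if i.val + j.val + 1 = 2 then (1 : L) else 0)).Local v ×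
      (cmDatum L 1 (Matrix.of fun i j : Fin 1 => if i.val + j.val + 1 = 1 then (1 : L) else 0)).Local v)) (t' : ((cmDatum L 2 (Matrix.of fun i j : Fin 2 => if i.val + j.val + 1 = 2 then (1 : L) else 0)).Local v ×
      (cmDatum L 1 (Matrix.of fun i j : Fin 1 => if i.val + j.val + 1 = 1 then (1 : L) else 0)).Local v)) → t = t'))
    -- the dock of `H♭ = Z_{G′}(ε)`, its base point, and the torus transport
    (ε : (cmDatum L 3 H').Local v) (θ : ((cmDatum L 2 (Matrix.of fun i j : Fin 2 => if i.val + j.val + 1 = 2 then (1 : L) else 0)).Local v ×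
      (cmDatum L 1 (Matrix.of fun i j : Fin 1 => if i.val + j.val + 1 = 1 then (1 : L) else 0)).Local v) ≃ₜ* ↥(Subgroup.centralizer ({ε} : Set ((cmDatum L 3 H').Local v)))) (εf : ((cmDatum L 2 (Matrix.of fun i j : Fin 2 => if i.val + j.val + 1 = 2 then (1 : L) else 0)).Local v ×
      (cmDatum L 1 (Matrix.of fun i j : Fin 1 => if i.val + j.val + 1 = 1 then (1 : L) else 0)).Local v)) (τ : ↥(Subgroup.centralizer ({εH} : Set ((cmDatum L 2 (Matrix.of fun i j : Fin 2 => if i.val + j.val + 1 = 2 then (1 : L) else 0)).Local v ×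
      (cmDatum L 1 (Matrix.of fun i j : Fin 1 => if i.val + j.val + 1 = 1 then (1 : L) else 0)).Local v))) → ((cmDatum L 2 (Matrix.of fun i j : Fin 2 => if i.val + j.val + 1 = 2 then (1 : L) else 0)).Local v ×
      (cmDatum L 1 (Matrix.of fun i j : Fin 1 => if i.val + j.val + 1 = 1 then (1 : L) else 0)).Local v)) (hτc : Continuous τ) (hτ₀ : τ b₀ = εf)
    (hτreg : ∀ t : ↥(Subgroup.centralizer ({εH} : Set ((cmDatum L 2 (Matrix.of fun i j : Fin 2 => if i.val + j.val + 1 = 2 then (1 : L) else 0)).Local v ×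
      (cmDatum L 1 (Matrix.of fun i j : Fin 1 => if i.val + j.val + 1 = 1 then (1 : L) else 0)).Local v))), IsLocalGRegular L v (t : ((cmDatum L 2 (Matrix.of fun i j : Fin 2 => if i.val + j.val + 1 = 2 then (1 : L) else 0)).Local v ×
      (cmDatum L 1 (Matrix.of fun i j : Fin 1 => if i.val + j.val + 1 = 1 then (1 : L) else 0)).Local v)) → IsLocalGRegular L v (τ t))
    -- the abstract bad side
    (Q' : ↥(Subgroup.centralizer ({εH} : Set ((cmDatum L 2 (Matrix.of fun i j : Fin 2 => if i.val + j.val + 1 = 2 then (1 : L) else 0)).Local v ×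
      (cmDatum L 1 (Matrix.of fun i j : Fin 1 => if i.val + j.val + 1 = 1 then (1 : L) else 0)).Local v))) → (cmDatum L 3 H').Local v → Prop)
    -- (SEP′) transported, on a STABLY SATURATED window
    (hsep' : ∃ B₇ ∈ 𝓝 εf, (∀ h ∈ B₇, ∀ h' : ((cmDatum L 2 (Matrix.of fun i j : Fin 2 => if i.val + j.val + 1 = 2 then (1 : L) else 0)).Local v ×
      (cmDatum L 1 (Matrix.of fun i j : Fin 1 => if i.val + j.val + 1 = 1 then (1 : L) else 0)).Local v), IsLocalStablyConjH L v h h' → h' ∈ B₇) ∧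
      ∀ h ∈ B₇, ∀ h' ∈ B₇, ∀ x : (cmDatum L 3 H').Local v, x * ((θ h : ↥(Subgroup.centralizer ({ε} : Set ((cmDatum L 3 H').Local v)))) : (cmDatum L 3 H').Local v) * x⁻¹ = ((θ h' : ↥(Subgroup.centralizer ({ε} : Set ((cmDatum L 3 H').Local v)))) : (cmDatum L 3 H').Local v) → IsConj h h')
    -- (U-s″) the SIDED uniform fibre at `ε_H`
    (hside : ∃ V₃ ∈ 𝓝 b₀, ∀ t ∈ V₃, IsLocalGRegular L v (t : ((cmDatum L 2 (Matrix.of fun i j : Fin 2 => if i.val + j.val + 1 = 2 then (1 : L) else 0)).Local v ×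
      (cmDatum L 1 (Matrix.of fun i j : Fin 1 => if i.val + j.val + 1 = 1 then (1 : L) else 0)).Local v)) → ∀ γ' : (cmDatum L 3 H').Local v, IsLocalNormPair L H' v (t : ((cmDatum L 2 (Matrix.of fun i j : Fin 2 => if i.val + j.val + 1 = 2 then (1 : L) else 0)).Local v ×
      (cmDatum L 1 (Matrix.of fun i j : Fin 1 => if i.val + j.val + 1 = 1 then (1 : L) else 0)).Local v)) γ' →
      (∃ x : (cmDatum L 3 H').Local v, ∃ h : ((cmDatum L 2 (Matrix.of fun i j : Fin 2 => if i.val + j.val + 1 = 2 then (1 : L) else 0)).Local v ×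
      (cmDatum L 1 (Matrix.of fun i j : Fin 1 => if i.val + j.val + 1 = 1 then (1 : L) else 0)).Local v), IsLocalStablyConjH L v (τ t) h ∧ x * γ' * x⁻¹ = ((θ h : ↥(Subgroup.centralizer ({ε} : Set ((cmDatum L 3 H').Local v)))) : (cmDatum L 3 H').Local v)) ∨ Q' t γ')
    -- the two sides never meet
    (hdisj : ∃ V₀ ∈ 𝓝 b₀, ∀ t ∈ V₀, ∀ γ' : (cmDatum L 3 H').Local v,
      (∃ x : (cmDatum L 3 H').Local v, ∃ h : ((cmDatum L 2 (Matrix.of fun i j : Fin 2 => if i.val + j.val + 1 = 2 then (1 : L) else 0)).Local v ×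
      (cmDatum L 1 (Matrix.of fun i j : Fin 1 => if i.val + j.val + 1 = 1 then (1 : L) else 0)).Local v), IsLocalStablyConjH L v (τ t) h ∧ x * γ' * x⁻¹ = ((θ h : ↥(Subgroup.centralizer ({ε} : Set ((cmDatum L 3 H').Local v)))) : (cmDatum L 3 H').Local v)) → Q' t γ' → False)
    -- `Q′ t` is a class function
    (hQ' : ∀ (t : ↥(Subgroup.centralizer ({εH} : Set ((cmDatum L 2 (Matrix.of fun i j : Fin 2 => if i.val + j.val + 1 = 2 then (1 : L) else 0)).Local v ×
      (cmDatum L 1 (Matrix.of fun i j : Fin 1 => if i.val + j.val + 1 = 1 then (1 : L) else 0)).Local v)))) (γ' x : (cmDatum L 3 H').Local v), Q' t γ' → Q' t (x * γ' * x⁻¹))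
    -- (D2ε) DESCENT at `ε` read on `H♭ = H_v` through `θ`, on a STABLY SATURATED window — the S1 object, base point `ε♭`
    (hD : ∀ ψ : (cmDatum L 3 H').Local v → ℂ, IsLocSmooth ψ → ∃ B ∈ 𝓝 εf, (∀ h ∈ B, ∀ h' : ((cmDatum L 2 (Matrix.of fun i j : Fin 2 => if i.val + j.val + 1 = 2 then (1 : L) else 0)).Local v ×
      (cmDatum L 1 (Matrix.of fun i j : Fin 1 => if i.val + j.val + 1 = 1 then (1 : L) else 0)).Local v), IsLocalStablyConjH L v h h' → h' ∈ B) ∧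
      ∃ ψε : ((cmDatum L 2 (Matrix.of fun i j : Fin 2 => if i.val + j.val + 1 = 2 then (1 : L) else 0)).Local v ×
      (cmDatum L 1 (Matrix.of fun i j : Fin 1 => if i.val + j.val + 1 = 1 then (1 : L) else 0)).Local v) → ℂ, IsLocSmooth ψε ∧
      ∀ h ∈ B, IsLocalGRegular L v h → classOrbitalIntegral mG ψ (ConjClasses.mk ((θ h : ↥(Subgroup.centralizer ({ε} : Set ((cmDatum L 3 H').Local v)))) : (cmDatum L 3 H').Local v)) = classOrbitalIntegral mH ψε (ConjClasses.mk h))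
    -- (R1-lc) the rank-one endoscopic transfer, locally-constant-extension dress
    (hR1 : ∀ ψε : ((cmDatum L 2 (Matrix.of fun i j : Fin 2 => if i.val + j.val + 1 = 2 then (1 : L) else 0)).Local v ×
      (cmDatum L 1 (Matrix.of fun i j : Fin 1 => if i.val + j.val + 1 = 1 then (1 : L) else 0)).Local v) → ℂ, IsLocSmooth ψε → ∃ V ∈ 𝓝 b₀, ∃ g : ↥(Subgroup.centralizer ({εH} : Set ((cmDatum L 2 (Matrix.of fun i j : Fin 2 => if i.val + j.val + 1 = 2 then (1 : L) else 0)).Local v ×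
      (cmDatum L 1 (Matrix.of fun i j : Fin 1 => if i.val + j.val + 1 = 1 then (1 : L) else 0)).Local v))) → ℂ, IsLocallyConstant g ∧
      ∀ t ∈ V, IsLocalGRegular L v (t : ((cmDatum L 2 (Matrix.of fun i j : Fin 2 => if i.val + j.val + 1 = 2 then (1 : L) else 0)).Local v ×
      (cmDatum L 1 (Matrix.of fun i j : Fin 1 => if i.val + j.val + 1 = 1 then (1 : L) else 0)).Local v)) →
        (∑ᶠ d ∈ {d : ConjClasses ((cmDatum L 2 (Matrix.of fun i j : Fin 2 => if i.val + j.val + 1 = 2 then (1 : L) else 0)).Local v ×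
      (cmDatum L 1 (Matrix.of fun i j : Fin 1 => if i.val + j.val + 1 = 1 then (1 : L) else 0)).Local v) | IsLocalStablyConjH L v (τ t) (Quotient.out d)},
          ((finExplicitCollection L H' μ hl hr) v).Δ (t : ((cmDatum L 2 (Matrix.of fun i j : Fin 2 => if i.val + j.val + 1 = 2 then (1 : L) else 0)).Local v ×
      (cmDatum L 1 (Matrix.of fun i j : Fin 1 => if i.val + j.val + 1 = 1 then (1 : L) else 0)).Local v)) ((θ (Quotient.out d) : ↥(Subgroup.centralizer ({ε} : Set ((cmDatum L 3 H').Local v)))) : (cmDatum L 3 H').Local v) * classOrbitalIntegral mH ψε d) = g t)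
    -- (Iε′₀) the compact side vanishes
    (hI0 : ∀ ψ : (cmDatum L 3 H').Local v → ℂ, IsLocSmooth ψ → ∃ V ∈ 𝓝 b₀, ∀ t ∈ V, IsLocalGRegular L v (t : ((cmDatum L 2 (Matrix.of fun i j : Fin 2 => if i.val + j.val + 1 = 2 then (1 : L) else 0)).Local v ×
      (cmDatum L 1 (Matrix.of fun i j : Fin 1 => if i.val + j.val + 1 = 1 then (1 : L) else 0)).Local v)) →
      (∑ᶠ c ∈ {c : ConjClasses ((cmDatum L 3 H').Local v) | Q' t (Quotient.out c)},
        ((finExplicitCollection L H' μ hl hr) v).Δ (t : ((cmDatum L 2 (Matrix.of fun i j : Fin 2 => if i.val + j.val + 1 = 2 then (1 : L) else 0)).Local v ×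
      (cmDatum L 1 (Matrix.of fun i j : Fin 1 => if i.val + j.val + 1 = 1 then (1 : L) else 0)).Local v)) (Quotient.out c) * classOrbitalIntegral mG ψ c) = 0)
    (φ : (cmDatum L 3 H').Local v → ℂ) (hφ : IsLocSmooth φ) :
    ∃ V ∈ 𝓝 εH, ∃ φH : ((cmDatum L 2 (Matrix.of fun i j : Fin 2 => if i.val + j.val + 1 = 2 then (1 : L) else 0)).Local v ×
      (cmDatum L 1 (Matrix.of fun i j : Fin 1 => if i.val + j.val + 1 = 1 then (1 : L) else 0)).Local v) → ℂ, IsLocSmooth φH ∧ ∀ γH ∈ V, IsLocalGRegular L v γH →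
      stableOrbitalIntegralRel (IsLocalStablyConjH L v) mH φH γH =
        ∑ᶠ c : ConjClasses ((cmDatum L 3 H').Local v), ((finExplicitCollection L H' μ hl hr) v).Δ γH (Quotient.out c) * classOrbitalIntegral mG φ c := by
  classical
  have hΔT : ∀ (a' : ((cmDatum L 2 (Matrix.of fun i j : Fin 2 => if i.val + j.val + 1 = 2 then (1 : L) else 0)).Local v ×
      (cmDatum L 1 (Matrix.of fun i j : Fin 1 => if i.val + j.val + 1 = 1 then (1 : L) else 0)).Local v)) (b : (cmDatum L 3 H').Local v), ((finExplicitCollection L H' μ hl hr) v).Δ a' b = finExplicitDelta L v H' a' μ b :=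
    fun a' b => finExplicitCollection_Δ L H' μ hl hr v a' b
  -- descent (saturated), separation (saturated): the good-side window `B ∋ ε♭`
  obtain ⟨B₄, hB₄, hB₄sat, φε, hφε, hdesc⟩ := hD φ hφ
  obtain ⟨B₇, hB₇, hB₇sat, hsep⟩ := hsep'
  set B : Set ((cmDatum L 2 (Matrix.of fun i j : Fin 2 => if i.val + j.val + 1 = 2 then (1 : L) else 0)).Local v ×
      (cmDatum L 1 (Matrix.of fun i j : Fin 1 => if i.val + j.val + 1 = 1 then (1 : L) else 0)).Local v) := B₄ ∩ B₇ with hBdef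
  have hB : B ∈ 𝓝 εf := inter_mem hB₄ hB₇
  have hBsat : ∀ h ∈ B, ∀ h' : ((cmDatum L 2 (Matrix.of fun i j : Fin 2 => if i.val + j.val + 1 = 2 then (1 : L) else 0)).Local v ×
      (cmDatum L 1 (Matrix.of fun i j : Fin 1 => if i.val + j.val + 1 = 1 then (1 : L) else 0)).Local v), IsLocalStablyConjH L v h h' → h' ∈ B :=
    fun h hh h' hst => ⟨hB₄sat h hh.1 h' hst, hB₇sat h hh.2 h' hst⟩
  have hτB : τ ⁻¹' B ∈ 𝓝 b₀ := hτc.continuousAt.preimage_mem_nhds (by rw [hτ₀]; exact hB)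
  -- the sided fibre, disjointness, the rank-one extension, the compact-side vanishing
  obtain ⟨V₃, hV₃, hsd⟩ := hside
  obtain ⟨V₀, hV₀, hdj⟩ := hdisj
  obtain ⟨V₈, hV₈, g, hg, hR⟩ := hR1 φε hφε
  obtain ⟨V₆, hV₆, hI⟩ := hI0 φ hφ
  -- shrink the torus chart into all of them
  obtain ⟨K, B₁, hKc, hKo, haK, hB₁c, hB₁o, hb₀B, hNB, hKB, hZ, hsatH, hsepH⟩ :=
    hNH _ (prod_mem_nhds univ_mem (inter_mem (inter_mem (inter_mem (inter_mem hV₃ hV₆) hτB) hV₈) hV₀))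
  have hBW : ∀ t ∈ B₁, t ∈ V₃ ∧ t ∈ V₆ ∧ t ∈ τ ⁻¹' B ∧ t ∈ V₈ ∧ t ∈ V₀ := fun t ht => by
    have h := (hNB (Set.mk_mem_prod haK ht)).2
    exact ⟨h.1.1.1.1, h.1.1.1.2, h.1.1.2, h.1.2, h.2⟩
  -- realisation of `g` on the torus box (pointwise-admissible)
  obtain ⟨ψ, hψ, hreal, -⟩ := OrbitalMeasureFamily.IsCanonical.exists_isLocSmooth_stableOrbitalIntegralRel_eq_of_chart_of_mem
    (fun g x hg => isLocalGRegular_of_isConj (isConj_iff.2 ⟨x, rfl⟩) hg) hmH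
    (Subgroup.centralizer ({εH} : Set ((cmDatum L 2 (Matrix.of fun i j : Fin 2 => if i.val + j.val + 1 = 2 then (1 : L) else 0)).Local v ×
      (cmDatum L 1 (Matrix.of fun i j : Fin 1 => if i.val + j.val + 1 = 1 then (1 : L) else 0)).Local v))) hTc ρ hρ eH sH hsHc Subtype.val heH hKc hKo haK hB₁c hB₁o hKB hZ hsatH
    (IsLocalStablyConjH L v) (fun a x => isStablyConjH_of_isConj (isConj_iff.2 ⟨x, rfl⟩))
    (fun _ _ h => IsStablyConjH.symm h) (fun _ _ _ h h' => IsStablyConjH.trans h h') hsepH g hg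
  -- the open set `V := e_H(K × B₁) ∋ ε_H`
  refine ⟨eH '' (K ×ˢ B₁), (eH.isOpen_image_of_subset_source (hKo.prod hB₁o) hKB).mem_nhds
    ⟨(aH, b₀), Set.mk_mem_prod haK hb₀B, by rw [heH _ (hKB (Set.mk_mem_prod haK hb₀B)), hsH₁, hb₀, one_mul, inv_one, mul_one]⟩, ψ, hψ, ?_⟩
  rintro γH ⟨⟨a₁, t⟩, hp, rfl⟩ hγreg
  have hpK : a₁ ∈ K := (Set.mem_prod.1 hp).1
  have htB : t ∈ B₁ := (Set.mem_prod.1 hp).2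
  rw [heH _ (hKB hp)] at hγreg ⊢
  -- down to the torus point `t`
  have htreg : IsLocalGRegular L v (t : ((cmDatum L 2 (Matrix.of fun i j : Fin 2 => if i.val + j.val + 1 = 2 then (1 : L) else 0)).Local v ×
      (cmDatum L 1 (Matrix.of fun i j : Fin 1 => if i.val + j.val + 1 = 1 then (1 : L) else 0)).Local v)) :=
    isLocalGRegular_of_isConj (isConj_iff.2 ⟨sH a₁, rfl⟩).symm hγreg
  have hst : IsLocalStablyConjH L v (t : ((cmDatum L 2 (Matrix.of fun i j : Fin 2 => if i.val + j.val + 1 = 2 then (1 : L) else 0)).Local v ×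
      (cmDatum L 1 (Matrix.of fun i j : Fin 1 => if i.val + j.val + 1 = 1 then (1 : L) else 0)).Local v)) (sH a₁ * (t : ((cmDatum L 2 (Matrix.of fun i j : Fin 2 => if i.val + j.val + 1 = 2 then (1 : L) else 0)).Local v ×
      (cmDatum L 1 (Matrix.of fun i j : Fin 1 => if i.val + j.val + 1 = 1 then (1 : L) else 0)).Local v)) * (sH a₁)⁻¹) :=
    isStablyConjH_of_isConj (isConj_iff.2 ⟨sH a₁, rfl⟩)
  have hSO : stableOrbitalIntegralRel (IsLocalStablyConjH L v) mH ψ (sH a₁ * (t : ((cmDatum L 2 (Matrix.of fun i j : Fin 2 => if i.val + j.val + 1 = 2 then (1 : L) else 0)).Local v ×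
      (cmDatum L 1 (Matrix.of fun i j : Fin 1 => if i.val + j.val + 1 = 1 then (1 : L) else 0)).Local v)) * (sH a₁)⁻¹) =
      stableOrbitalIntegralRel (IsLocalStablyConjH L v) mH ψ (t : ((cmDatum L 2 (Matrix.of fun i j : Fin 2 => if i.val + j.val + 1 = 2 then (1 : L) else 0)).Local v ×
      (cmDatum L 1 (Matrix.of fun i j : Fin 1 => if i.val + j.val + 1 = 1 then (1 : L) else 0)).Local v)) := by
    symm
    exact stableOrbitalIntegralRel_congr_of_rel (stA := IsLocalStablyConjH L v) (fun _ _ h => IsStablyConjH.symm h)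
      (fun _ _ _ h h' => IsStablyConjH.trans h h') mH ψ hst
  rw [hSO, hreal t htB htreg]
  have hfun : (fun c : ConjClasses ((cmDatum L 3 H').Local v) => ((finExplicitCollection L H' μ hl hr) v).Δ (sH a₁ * (t : ((cmDatum L 2 (Matrix.of fun i j : Fin 2 => if i.val + j.val + 1 = 2 then (1 : L) else 0)).Local v ×
      (cmDatum L 1 (Matrix.of fun i j : Fin 1 => if i.val + j.val + 1 = 1 then (1 : L) else 0)).Local v)) * (sH a₁)⁻¹) (Quotient.out c) *
      classOrbitalIntegral mG φ c) = fun c => ((finExplicitCollection L H' μ hl hr) v).Δ (t : ((cmDatum L 2 (Matrix.of fun i j : Fin 2 => if i.val + j.val + 1 = 2 then (1 : L) else 0)).Local v ×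
      (cmDatum L 1 (Matrix.of fun i j : Fin 1 => if i.val + j.val + 1 = 1 then (1 : L) else 0)).Local v)) (Quotient.out c) * classOrbitalIntegral mG φ c :=
    funext fun c => by rw [hΔT, hΔT, hl]
  rw [hfun]
  obtain ⟨ht₃, ht₆, htτ, ht₈, ht₀⟩ := hBW t htB
  have hτt : IsLocalGRegular L v (τ t) := hτreg t htreg
  have hτtB : τ t ∈ B := htτ
  -- FILE 1's torus-point identity, abstract bad side `Q := Q′ t ∘ out`
  refine (finsum_delta_mul_classOrbitalIntegral_eq_of_sides_of_pred L H' v hH' hdet' μ hl hr mH mG θ (t : ((cmDatum L 2 (Matrix.of fun i j : Fin 2 => if i.val + j.val + 1 = 2 then (1 : L) else 0)).Local v ×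
      (cmDatum L 1 (Matrix.of fun i j : Fin 1 => if i.val + j.val + 1 = 1 then (1 : L) else 0)).Local v)) (τ t) B
    (fun c => Q' t (Quotient.out c)) φ φε (g t) htreg hτt hφ ?_ ?_ ?_
    (fun h hh h' hh' x hx => hsep h hh.2 h' hh'.2 x hx) (fun h hhB hh => hdesc h hhB.1 hh) (hR t ht₈ htreg) (hI t ht₆ htreg)).symm
  · -- sided fibre: the good-side witness lies in the saturated window `B ∋ τ t`
    intro γ' hR'
    rcases hsd t ht₃ htreg γ' hR' with ⟨x, h, hsth, hx⟩ | hq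
    · exact Or.inl ⟨x, h, hBsat (τ t) hτtB h hsth, hsth, hx⟩
    · right
      obtain ⟨z, hz⟩ := isConj_iff.1 (ConjClasses.mk_eq_mk_iff_isConj.1
        (show ConjClasses.mk (Quotient.out (ConjClasses.mk γ')) = ConjClasses.mk γ' by rw [← ConjClasses.quotient_mk_eq_mk, Quotient.out_eq]).symm)
      rw [← hz]
      exact hQ' t γ' z hq
  · -- never both
    rintro c ⟨x, h, -, hsth, hx⟩ hq
    exact hdj t ht₀ (Quotient.out c) ⟨x, h, hsth, hx⟩ hq
  · -- saturation into `B` is free: `B` is stably saturated and contains `τ t`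
    intro h' hst'
    exact ⟨1, by rw [one_mul, inv_one, mul_one]; exact hBsat (τ t) hτtB h' hst'⟩

end TorusSingularInv

end Literature.NumberTheory.Rogawski1990

end
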